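import Literature.Computability.AlgebraicComplexity.DeterminantalComplexityProofs
import Literature.Computability.AlgebraicComplexity.DeterminantalConormalBoundKernelAlgebra
import Literature.Computability.AlgebraicComplexity.ZariskiClosureBaseChange

/-!
# Affine determinantal representations descend to an algebraically closed subfield
# (Nullstellensatz / Lefschetz principle for `dc`)

Topic `Literature/Computability/AlgebraicComplexity`. THEOREMS ONLY (no definition, no named fact).

For a field extension `k ⊆ K` with `k` ALGEBRAICALLY CLOSED and a polynomial `f ∈ k[x_σ]` (`σ` finite),
every affine determinantal representation of `f ⊗_k K` of size `m` over `K` yields one of size `m`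
over `k` (`HasDetRepr.of_map_of_isAlgClosed`); with the trivial ascent (`HasDetRepr.map_holds`) the
property `HasDetRepr _ m` and hence the determinantal complexity are the SAME over `k` and over `K`
(`hasDetRepr_map_iff_of_isAlgClosed`, `determinantalComplexity_map_of_isAlgClosed`). In particular
`dc_K(per_n) = dc_k(per_n)` (`determinantalComplexity_perPoly_of_isAlgClosed`), e.g.
`dc_ℂ(per_n) = dc_{ℚ̄}(per_n)` for any embedding `ℚ̄ → ℂ`: the exact analogue of the border statement
`BorderDetComplexityCharZero.lean` (where Zariski closures make plain base change suffice).

Proof (folklore; Bürgisser 2000 §4.1 discusses the (in)dependence of Valiant's classes on the field):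
the size-`m` affine representations of `f` are the points of an affine `k`-variety — unknowns = the
`m²(|σ|+1)` coefficients of the affine entries (`affineMatrixOf`), equations = the coefficients of
`det − f` (`reprIdeal`, through the generic matrix over `k[coefficients]`; `RingHom.map_det`,
`MvPolynomial.coeff_map`). A `K`-representation is a `K`-point (affine expansion of its entries,
`eq_C_add_sum_of_totalDegree_le_one`), so by the Nullstellensatz over the algebraically closed `k`
(tree `exists_mem_zeroLocus_of_mem_zeroLocus`, `ZariskiClosureBaseChange.lean`: a `k`-system with a
solution in an extension field has a solution in `k`) there is a `k`-point, i.e. a `k`-representation.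

Consumer: the registered stub `stub_algebraicRepr` of `Cruxes/TotalRankNotQP/Lines/ConstantEliminationQP_birth.lean`
(a `ℂ`-representation of `per_n` gives a `ℚ̄`-representation of the same size). Honest framing:
bookkeeping; nothing here bears on `VP ≠ VNP`, which is NOT proved.

## References
* [Burgisser2000] P. Bürgisser, *Completeness and Reduction in Algebraic Complexity Theory*, §4.1
  (dependence on the field; algebraically closed fields of the same characteristic).
* [AtiyahMacdonald1969] M. Atiyah, I. Macdonald, *Introduction to Commutative Algebra*, Cor. 7.10
  (Nullstellensatz).
-/

noncomputable section

open MvPolynomial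

namespace Literature.Computability.AlgebraicComplexity

namespace DetReprDescent

variable {σ : Type*} [Fintype σ] {m : ℕ}

/-- Coefficient variables of a size-`m` affine matrix in the variables `σ`: a constant term
(`none`) and one linear coefficient per variable (`some v`) for every entry `(a, b)`. [folklore] -/
abbrev CoeffIdx (σ : Type*) (m : ℕ) : Type _ := (Fin m × Fin m) × Option σ

/-- The affine matrix with coefficient vector `x`: entry `(a,b)` is
`x_{(a,b),∅} + Σ_v x_{(a,b),v} · X_v`. [folklore] -/
def affineMatrixOf {L : Type*} [CommSemiring L] (x : CoeffIdx σ m → L) :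
    Matrix (Fin m) (Fin m) (MvPolynomial σ L) :=
  fun a b => C (x ((a, b), none)) + ∑ v : σ, C (x ((a, b), some v)) * X v

/-- The entries of `affineMatrixOf x` are affine (total degree `≤ 1`). [folklore] -/
private theorem totalDegree_affineMatrixOf_le {L : Type*} [CommSemiring L] (x : CoeffIdx σ m → L)
    (a b : Fin m) : (affineMatrixOf x a b).totalDegree ≤ 1 := by
  unfold affineMatrixOf
  refine (totalDegree_add _ _).trans (max_le ?_ ?_)
  · rw [totalDegree_C]; exact zero_le_one
  · refine totalDegree_finsetSum_le fun v _ => ?_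
    refine (totalDegree_mul _ _).trans ?_
    rw [totalDegree_C, zero_add]
    by_cases h : Nontrivial L
    · exact (totalDegree_X v).le
    · haveI : Subsingleton L := not_nontrivial_iff_subsingleton.1 h
      rw [Subsingleton.elim (X v : MvPolynomial σ L) 0, totalDegree_zero]; exact zero_le_one

/-- Base change of the affine matrix along a ring map: entrywise `map ψ`. [folklore] -/
private theorem affineMatrixOf_map {L L' : Type*} [CommSemiring L] [CommSemiring L'] (ψ : L →+* L')
    (x : CoeffIdx σ m → L) :
    (affineMatrixOf x).map (MvPolynomial.map ψ) = affineMatrixOf (ψ ∘ x) := by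
  ext a b : 2
  simp only [affineMatrixOf, Matrix.map_apply, map_add, map_sum, map_mul, MvPolynomial.map_C,
    MvPolynomial.map_X, Function.comp_apply]

/-- Base change of its determinant. [folklore] -/
private theorem map_det_affineMatrixOf {L L' : Type*} [CommRing L] [CommRing L'] (ψ : L →+* L')
    (x : CoeffIdx σ m → L) :
    MvPolynomial.map ψ (affineMatrixOf x).det = (affineMatrixOf (ψ ∘ x)).det := by
  rw [RingHom.map_det, RingHom.mapMatrix_apply, affineMatrixOf_map]

/-- An affine matrix is the affine matrix of its coefficient vector. [folklore] -/
private theorem affineMatrixOf_coeff_eq {L : Type*} [CommSemiring L] (A : Matrix (Fin m) (Fin m) (MvPolynomial σ L))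
    (hA : ∀ a b, (A a b).totalDegree ≤ 1) :
    affineMatrixOf (fun t : CoeffIdx σ m =>
        Option.elim t.2 (coeff 0 (A t.1.1 t.1.2)) fun v => coeff (Finsupp.single v 1) (A t.1.1 t.1.2)) = A := by
  refine Matrix.ext fun a b => ?_
  simp only [affineMatrixOf, Option.elim]
  exact (DeterminantalConormal.eq_C_add_sum_of_totalDegree_le_one (hA a b)).symm

variable {k : Type*} [Field k]

/-- The ideal of the representation variety of `f` at size `m`: generated by the coefficients of
`det (generic affine matrix) − f` in the polynomial ring over the coefficient variables. [folklore] -/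
def reprIdeal (f : MvPolynomial σ k) (m : ℕ) : Ideal (MvPolynomial (CoeffIdx σ m) k) :=
  Ideal.span (Set.range fun d : σ →₀ ℕ =>
    coeff d (affineMatrixOf (X : CoeffIdx σ m → MvPolynomial (CoeffIdx σ m) k)).det - C (coeff d f))

/-- Evaluating the generic determinant's coefficients at a point `x` gives the coefficients of the
determinant of the affine matrix of `x`. [folklore] -/
private theorem aeval_coeff_det_generic {L : Type*} [Field L] [Algebra k L] (x : CoeffIdx σ m → L)
    (d : σ →₀ ℕ) :
    aeval x (coeff d (affineMatrixOf (X : CoeffIdx σ m → MvPolynomial (CoeffIdx σ m) k)).det) =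
      coeff d (affineMatrixOf x).det := by
  have h := coeff_map ((aeval x : MvPolynomial (CoeffIdx σ m) k →ₐ[k] L) : MvPolynomial (CoeffIdx σ m) k →+* L)
    (affineMatrixOf (X : CoeffIdx σ m → MvPolynomial (CoeffIdx σ m) k)).det d
  rw [RingHom.coe_coe] at h
  rw [← h, map_det_affineMatrixOf]
  have hx : ((aeval x : MvPolynomial (CoeffIdx σ m) k →ₐ[k] L) : MvPolynomial (CoeffIdx σ m) k →+* L) ∘
      (X : CoeffIdx σ m → MvPolynomial (CoeffIdx σ m) k) = x := by
    funext t
    simp only [Function.comp_apply, RingHom.coe_coe, aeval_X]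
  rw [hx]

/-- **Points of the representation variety are representations**: `x` is a zero of `reprIdeal f m`
(over any extension field `L` of `k`) iff the affine matrix of `x` has determinant `f ⊗ L`. [folklore] -/
private theorem mem_zeroLocus_reprIdeal_iff {L : Type*} [Field L] [Algebra k L] (f : MvPolynomial σ k)
    (x : CoeffIdx σ m → L) :
    x ∈ MvPolynomial.zeroLocus L (reprIdeal f m) ↔
      (affineMatrixOf x).det = MvPolynomial.map (algebraMap k L) f := by
  rw [reprIdeal, MvPolynomial.zeroLocus_span]
  simp only [Set.mem_setOf_eq, Set.forall_mem_range, map_sub, aeval_coeff_det_generic, aeval_C,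
    sub_eq_zero]
  constructor
  · intro h
    ext d
    rw [coeff_map, h d]
  · intro h d
    rw [h, coeff_map]

end DetReprDescent

open DetReprDescent

variable {σ : Type*} [Fintype σ]

/-- **Descent of affine determinantal representations to an algebraically closed subfield**: if
`k` is algebraically closed, `K ⊇ k` is any field and `f ⊗_k K` has an affine determinantal
representation of size `m` over `K`, then `f` has one of size `m` over `k`. (The representation
variety is defined over `k` and has a `K`-point, hence a `k`-point by the Nullstellensatz.)
[cite: AtiyahMacdonald1969, Cor. 7.10] [cite: Burgisser2000, §4.1] -/
theorem HasDetRepr.of_map_of_isAlgClosed {k K : Type*} [Field k] [IsAlgClosed k] [Field K]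
    [Algebra k K] {f : MvPolynomial σ k} {m : ℕ}
    (h : HasDetRepr (MvPolynomial.map (algebraMap k K) f) m) : HasDetRepr f m := by
  classical
  obtain ⟨A, hA, hdet⟩ := h
  -- the `K`-point of the representation variety given by the coefficients of `A`
  set y : CoeffIdx σ m → K := fun t =>
    Option.elim t.2 (coeff 0 (A t.1.1 t.1.2)) fun v => coeff (Finsupp.single v 1) (A t.1.1 t.1.2) with hy
  have hyA : affineMatrixOf y = A := affineMatrixOf_coeff_eq A hA
  have hymem : y ∈ MvPolynomial.zeroLocus K (reprIdeal f m) := by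
    rw [mem_zeroLocus_reprIdeal_iff, hyA, hdet]
  -- Nullstellensatz: a `k`-point
  obtain ⟨x, hx⟩ := exists_mem_zeroLocus_of_mem_zeroLocus (reprIdeal f m) hymem
  rw [mem_zeroLocus_reprIdeal_iff, Algebra.algebraMap_self, MvPolynomial.map_id] at hx
  exact ⟨affineMatrixOf x, totalDegree_affineMatrixOf_le x, hx⟩

/-- **`HasDetRepr` is invariant under extension of an algebraically closed field**:
`f ⊗_k K` has a size-`m` affine determinantal representation over `K` iff `f` has one over `k`
(descent above; ascent `HasDetRepr.map_holds`). [cite: Burgisser2000, §4.1] -/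
theorem hasDetRepr_map_iff_of_isAlgClosed {k K : Type*} [Field k] [IsAlgClosed k] [Field K]
    [Algebra k K] (f : MvPolynomial σ k) (m : ℕ) :
    HasDetRepr (MvPolynomial.map (algebraMap k K) f) m ↔ HasDetRepr f m :=
  ⟨HasDetRepr.of_map_of_isAlgClosed, fun h => HasDetRepr.map_holds h (algebraMap k K)⟩

/-- **Determinantal complexity is invariant under extension of an algebraically closed field**:
`dc_K(f ⊗ K) = dc_k(f)`. [cite: Burgisser2000, §4.1] -/
theorem determinantalComplexity_map_of_isAlgClosed {k K : Type*} [Field k] [IsAlgClosed k]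
    [Field K] [Algebra k K] (f : MvPolynomial σ k) :
    determinantalComplexity (MvPolynomial.map (algebraMap k K) f) = determinantalComplexity f := by
  unfold determinantalComplexity
  congr 1
  ext m
  exact hasDetRepr_map_iff_of_isAlgClosed f m

/-- **`dc(per_n)` is the same over an algebraically closed field and over any extension field**
(`perPoly` is defined over the prime ring, `map_perPoly`): `dc_K(per_n) = dc_k(per_n)`; e.g.
`dc_ℂ(per_n) = dc_{ℚ̄}(per_n)` along any embedding `ℚ̄ → ℂ`. [cite: Burgisser2000, §4.1] -/
theorem determinantalComplexity_perPoly_of_isAlgClosed (k K : Type*) [Field k] [IsAlgClosed k]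
    [Field K] [Algebra k K] (ι : Type*) [Fintype ι] [DecidableEq ι] :
    determinantalComplexity (perPoly ι K) = determinantalComplexity (perPoly ι k) := by
  rw [← map_perPoly (algebraMap k K), determinantalComplexity_map_of_isAlgClosed]

/-- The same for representability at a given size: `per_n ⊗ K` has a size-`m` representation over
`K` iff `per_n` has one over the algebraically closed subfield `k`. [cite: Burgisser2000, §4.1] -/
theorem hasDetRepr_perPoly_iff_of_isAlgClosed (k K : Type*) [Field k] [IsAlgClosed k]
    [Field K] [Algebra k K] (ι : Type*) [Fintype ι] [DecidableEq ι] (m : ℕ) :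
    HasDetRepr (perPoly ι K) m ↔ HasDetRepr (perPoly ι k) m := by
  rw [← map_perPoly (algebraMap k K), hasDetRepr_map_iff_of_isAlgClosed]

end Literature.Computability.AlgebraicComplexity

end
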